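import Summits.AnomalousDissipation.AnomalousDissipation.Statement

/-!
# Solo (blind) — the zeroth law in filter form, and its negation as a uniform dissipation ceiling

`Literature.Turb.ZerothLaw` (`S`) quantifies over SEQUENCES of viscosities `ν_j → 0⁺` and, for each
`j`, over ONE global Leray–Hopf solution from ONE datum. This file records the equivalent filter form
of `S` and — the point of the file — the exact shape of the NEGATION `¬S`, which is a statement
uniform over all data and all Leray–Hopf solutions:

* `zerothLaw_iff_frequently_nhdsGT` — `S` holds iff for some smooth divergence-free mean-zero steady
  force `f`, some energy level `E` and some `ε > 0`, FREQUENTLY as `ν → 0⁺` (`∃ᶠ ν in 𝓝[>] 0`) there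
  is a global Leray–Hopf solution of `NS_ν(f)` from some finite-energy datum with mean energy `≤ E`
  and mean dissipation `≥ ε`;
* `not_zerothLaw_iff_uniform_ceiling` — `¬S` holds iff for EVERY smooth divergence-free mean-zero
  steady force `f`, every `E` and every `ε > 0`, EVENTUALLY as `ν → 0⁺`, EVERY global Leray–Hopf
  solution of `NS_ν(f)` from EVERY datum whose mean energy is `≤ E` has mean dissipation `< ε`.
  In words: for every `f` and `E` the dissipation ceiling
  `d_f(ν, E) = sup {⟨ν‖∇u‖₂²⟩ : u a global Leray–Hopf solution of NS_ν(f), any datum, ⟨‖u‖₂²⟩ ≤ E}`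
  tends to `0` as `ν → 0⁺` — a disproof of the zeroth law must bound the dissipation of the WHOLE
  bounded-energy Leray–Hopf solution set of every smooth steady stirring, not of one flow;
* `not_zerothLaw_iff_exists_threshold` — the same with an explicit threshold `ν₀(f, E, ε) > 0`
  below which every such solution dissipates less than `ε`;
* `zerothLaw_of_frequently` / `uniform_ceiling_of_not_zerothLaw` — the two directions most often
  wanted, as standalone implications.

No analysis is involved: the passage sequence ↔ filter is countable generation of `𝓝[>] (0 : ℝ)`
(`Filter.exists_seq_forall_of_frequently`) plus an index shift making every term of the extracted
sequence positive (`exists_seq_pos_tendsto_of_frequently_nhdsGT`), and the threshold form is the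
interval basis of `𝓝[>] 0` (`nhdsGT_basis`). [folklore]
-/

open MeasureTheory Filter Topology Set Function
open scoped ENNReal NNReal

noncomputable section

namespace Summit.AnomalousDissipation.AnomalousDissipation.Theorems

open Literature.Analysis.FunctionSpaces Literature.Analysis.FunctionSpaces.Torus
open Literature.Analysis.FluidPDE

/-! ### Sequences versus the filter `𝓝[>] 0` -/

/-- A property holding along a sequence of positive reals tending to `0` holds frequently as
`ν → 0⁺`. [folklore] -/
theorem frequently_nhdsGT_of_seq {p : ℝ → Prop} (ν : ℕ → ℝ) (hpos : ∀ j, 0 < ν j)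
    (hlim : Tendsto ν atTop (𝓝 0)) (hp : ∀ j, p (ν j)) : ∃ᶠ x in 𝓝[>] (0 : ℝ), p x :=
  (tendsto_nhdsWithin_iff.2 ⟨hlim, Eventually.of_forall fun j => mem_Ioi.2 (hpos j)⟩).frequently
    (Frequently.of_forall hp)

/-- Conversely, a property holding frequently as `ν → 0⁺` holds along SOME sequence of positive
reals tending to `0`, every term of which is positive (countable generation of `𝓝[>] 0` and an
index shift). [folklore] -/
theorem exists_seq_pos_tendsto_of_frequently_nhdsGT {p : ℝ → Prop}
    (h : ∃ᶠ x in 𝓝[>] (0 : ℝ), p x) :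
    ∃ ν : ℕ → ℝ, (∀ j, 0 < ν j) ∧ Tendsto ν atTop (𝓝 0) ∧ ∀ j, p (ν j) := by
  obtain ⟨ns, hns, hp⟩ := exists_seq_forall_of_frequently h
  rw [tendsto_nhdsWithin_iff] at hns
  obtain ⟨N, hN⟩ := eventually_atTop.1 hns.2
  refine ⟨fun j => ns (j + N), fun j => mem_Ioi.1 (hN _ (Nat.le_add_left N j)),
    hns.1.comp (tendsto_add_atTop_nat N), fun j => hp _⟩

/-- Threshold form of `∀ᶠ ν in 𝓝[>] 0`: a property holds eventually as `ν → 0⁺` iff it holds on a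
whole interval `(0, ν₀)`, `ν₀ > 0`. [folklore] -/
theorem eventually_nhdsGT_zero_iff_exists_threshold {p : ℝ → Prop} :
    (∀ᶠ x in 𝓝[>] (0 : ℝ), p x) ↔ ∃ ν₀ : ℝ, 0 < ν₀ ∧ ∀ ν : ℝ, 0 < ν → ν < ν₀ → p ν := by
  rw [(nhdsGT_basis (0 : ℝ)).eventually_iff]
  constructor
  · rintro ⟨ν₀, hν₀, h⟩
    exact ⟨ν₀, hν₀, fun ν hν hνlt => h ⟨hν, hνlt⟩⟩
  · rintro ⟨ν₀, hν₀, h⟩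
    exact ⟨ν₀, hν₀, fun ν hν => h ν hν.1 hν.2⟩

/-! ### The zeroth law in filter form -/

/-- **`ZerothLaw` in filter form.** The zeroth law holds iff for some smooth divergence-free
mean-zero steady force `f`, some `E` and some `ε > 0`, frequently as `ν → 0⁺` there is a global
Leray–Hopf solution of `NS_ν(f)` (from some datum) with mean energy `≤ E` and mean dissipation
`≥ ε`. [folklore] -/
theorem zerothLaw_iff_frequently_nhdsGT :
    Literature.Turb.ZerothLaw ↔
      ∃ f : UnitAddTorus (Fin 3) → EuclideanSpace ℝ (Fin 3), IsSmooth f ∧ IsDivFree f ∧ HasZeroMean f ∧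
        ∃ E ε : ℝ, 0 < ε ∧ ∃ᶠ ν in 𝓝[>] (0 : ℝ),
          ∃ (u₀ : UnitAddTorus (Fin 3) → EuclideanSpace ℝ (Fin 3))
            (u : ℝ → UnitAddTorus (Fin 3) → EuclideanSpace ℝ (Fin 3)),
            Torus.IsGlobalLerayHopf ν (fun _ => f) u₀ u ∧ meanEnergy u ≤ E ∧ ε ≤ meanDissipation ν u := by
  constructor
  · rintro ⟨f, hf, hdiv, hf0, ν, u₀, u, hν, hν0, hLH, ⟨E, hE⟩, ε, hε, hεle⟩
    exact ⟨f, hf, hdiv, hf0, E, ε, hε,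
      frequently_nhdsGT_of_seq ν hν hν0 fun j => ⟨u₀ j, u j, hLH j, hE j, hεle j⟩⟩
  · rintro ⟨f, hf, hdiv, hf0, E, ε, hε, hfreq⟩
    obtain ⟨ν, hν, hν0, hP⟩ := exists_seq_pos_tendsto_of_frequently_nhdsGT hfreq
    choose u₀ u hLH hE hεle using hP
    exact ⟨f, hf, hdiv, hf0, ν, u₀, u, hν, hν0, hLH, ⟨E, hE⟩, ε, hε, hεle⟩

/-- **Door (frequently-form).** To prove the zeroth law it suffices to exhibit one smooth
divergence-free mean-zero steady force `f`, a level `E` and an `ε > 0` such that frequently as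
`ν → 0⁺` some global Leray–Hopf solution of `NS_ν(f)` has mean energy `≤ E` and mean dissipation
`≥ ε` — no sequence bookkeeping. [folklore] -/
theorem zerothLaw_of_frequently {f : UnitAddTorus (Fin 3) → EuclideanSpace ℝ (Fin 3)}
    (hf : IsSmooth f) (hdiv : IsDivFree f) (hf0 : HasZeroMean f) {E ε : ℝ} (hε : 0 < ε)
    (h : ∃ᶠ ν in 𝓝[>] (0 : ℝ),
      ∃ (u₀ : UnitAddTorus (Fin 3) → EuclideanSpace ℝ (Fin 3))
        (u : ℝ → UnitAddTorus (Fin 3) → EuclideanSpace ℝ (Fin 3)),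
        Torus.IsGlobalLerayHopf ν (fun _ => f) u₀ u ∧ meanEnergy u ≤ E ∧ ε ≤ meanDissipation ν u) :
    Literature.Turb.ZerothLaw :=
  zerothLaw_iff_frequently_nhdsGT.2 ⟨f, hf, hdiv, hf0, E, ε, hε, h⟩

/-! ### The negation: a uniform dissipation ceiling -/

/-- **`¬ ZerothLaw` is a UNIFORM CEILING.** The zeroth law fails iff for every smooth
divergence-free mean-zero steady force `f`, every energy level `E` and every `ε > 0`, eventually as
`ν → 0⁺`, EVERY global Leray–Hopf solution of `NS_ν(f)` from EVERY datum with mean energy `≤ E` has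
mean dissipation `< ε`; i.e. for every `f` and `E` the dissipation ceiling over the bounded-energy
Leray–Hopf solution set, `d_f(ν, E) = sup {⟨ν‖∇u‖₂²⟩ : ⟨‖u‖₂²⟩ ≤ E}`, tends to `0` as `ν → 0⁺`.
[folklore] -/
theorem not_zerothLaw_iff_uniform_ceiling :
    ¬ Literature.Turb.ZerothLaw ↔
      ∀ f : UnitAddTorus (Fin 3) → EuclideanSpace ℝ (Fin 3), IsSmooth f → IsDivFree f → HasZeroMean f →
        ∀ E ε : ℝ, 0 < ε → ∀ᶠ ν in 𝓝[>] (0 : ℝ),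
          ∀ (u₀ : UnitAddTorus (Fin 3) → EuclideanSpace ℝ (Fin 3))
            (u : ℝ → UnitAddTorus (Fin 3) → EuclideanSpace ℝ (Fin 3)),
            Torus.IsGlobalLerayHopf ν (fun _ => f) u₀ u → meanEnergy u ≤ E → meanDissipation ν u < ε := by
  rw [zerothLaw_iff_frequently_nhdsGT]
  constructor
  · intro h f hf hdiv hf0 E ε hε
    have h' : ¬ ∃ᶠ ν in 𝓝[>] (0 : ℝ),
        ∃ (u₀ : UnitAddTorus (Fin 3) → EuclideanSpace ℝ (Fin 3))
          (u : ℝ → UnitAddTorus (Fin 3) → EuclideanSpace ℝ (Fin 3)),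
          Torus.IsGlobalLerayHopf ν (fun _ => f) u₀ u ∧ meanEnergy u ≤ E ∧ ε ≤ meanDissipation ν u :=
      fun hfreq => h ⟨f, hf, hdiv, hf0, E, ε, hε, hfreq⟩
    refine (not_frequently.1 h').mono fun ν hν u₀ u hLH hEu => ?_
    by_contra hlt
    exact hν ⟨u₀, u, hLH, hEu, not_lt.1 hlt⟩
  · rintro h ⟨f, hf, hdiv, hf0, E, ε, hε, hfreq⟩
    have hev := h f hf hdiv hf0 E ε hε
    obtain ⟨ν, ⟨u₀, u, hLH, hEu, hεle⟩, hν⟩ := (hfreq.and_eventually hev).exists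
    exact absurd (hν u₀ u hLH hEu) (not_lt.2 hεle)

/-- **`¬ ZerothLaw` with an explicit threshold.** The zeroth law fails iff for every smooth
divergence-free mean-zero steady force `f`, every `E` and every `ε > 0` there is `ν₀ > 0` such that
for every viscosity `0 < ν < ν₀`, every global Leray–Hopf solution of `NS_ν(f)` from every datum
with mean energy `≤ E` has mean dissipation `< ε`. [folklore] -/
theorem not_zerothLaw_iff_exists_threshold :
    ¬ Literature.Turb.ZerothLaw ↔
      ∀ f : UnitAddTorus (Fin 3) → EuclideanSpace ℝ (Fin 3), IsSmooth f → IsDivFree f → HasZeroMean f →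
        ∀ E ε : ℝ, 0 < ε → ∃ ν₀ : ℝ, 0 < ν₀ ∧ ∀ ν : ℝ, 0 < ν → ν < ν₀ →
          ∀ (u₀ : UnitAddTorus (Fin 3) → EuclideanSpace ℝ (Fin 3))
            (u : ℝ → UnitAddTorus (Fin 3) → EuclideanSpace ℝ (Fin 3)),
            Torus.IsGlobalLerayHopf ν (fun _ => f) u₀ u → meanEnergy u ≤ E → meanDissipation ν u < ε := by
  rw [not_zerothLaw_iff_uniform_ceiling]
  refine forall₄_congr fun f _ _ _ => forall₃_congr fun E ε _ => ?_
  exact eventually_nhdsGT_zero_iff_exists_threshold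

/-- **The burden of a disproof, as an implication.** If the zeroth law fails, then for every smooth
divergence-free mean-zero steady force, every energy level `E` and every `ε > 0`, below some
positive viscosity threshold every bounded-energy (`≤ E`) global Leray–Hopf solution dissipates
less than `ε` on average. [folklore] -/
theorem uniform_ceiling_of_not_zerothLaw (h : ¬ Literature.Turb.ZerothLaw)
    {f : UnitAddTorus (Fin 3) → EuclideanSpace ℝ (Fin 3)}
    (hf : IsSmooth f) (hdiv : IsDivFree f) (hf0 : HasZeroMean f) (E : ℝ) {ε : ℝ} (hε : 0 < ε) :
    ∃ ν₀ : ℝ, 0 < ν₀ ∧ ∀ ν : ℝ, 0 < ν → ν < ν₀ →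
      ∀ (u₀ : UnitAddTorus (Fin 3) → EuclideanSpace ℝ (Fin 3))
        (u : ℝ → UnitAddTorus (Fin 3) → EuclideanSpace ℝ (Fin 3)),
        Torus.IsGlobalLerayHopf ν (fun _ => f) u₀ u → meanEnergy u ≤ E → meanDissipation ν u < ε :=
  not_zerothLaw_iff_exists_threshold.1 h f hf hdiv hf0 E ε hε

/-- **Contrapositive door.** If for one smooth divergence-free mean-zero steady force `f`, one
level `E` and one `ε > 0`, below EVERY positive threshold `ν₀` some viscosity `ν ∈ (0, ν₀)` carries a
global Leray–Hopf solution of `NS_ν(f)` with mean energy `≤ E` and mean dissipation `≥ ε`, then the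
zeroth law holds. [folklore] -/
theorem zerothLaw_of_forall_threshold {f : UnitAddTorus (Fin 3) → EuclideanSpace ℝ (Fin 3)}
    (hf : IsSmooth f) (hdiv : IsDivFree f) (hf0 : HasZeroMean f) {E ε : ℝ} (hε : 0 < ε)
    (h : ∀ ν₀ : ℝ, 0 < ν₀ → ∃ ν : ℝ, 0 < ν ∧ ν < ν₀ ∧
      ∃ (u₀ : UnitAddTorus (Fin 3) → EuclideanSpace ℝ (Fin 3))
        (u : ℝ → UnitAddTorus (Fin 3) → EuclideanSpace ℝ (Fin 3)),
        Torus.IsGlobalLerayHopf ν (fun _ => f) u₀ u ∧ meanEnergy u ≤ E ∧ ε ≤ meanDissipation ν u) :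
    Literature.Turb.ZerothLaw := by
  by_contra hS
  obtain ⟨ν₀, hν₀, hall⟩ := uniform_ceiling_of_not_zerothLaw hS hf hdiv hf0 E hε
  obtain ⟨ν, hν, hνlt, u₀, u, hLH, hEu, hεle⟩ := h ν₀ hν₀
  exact absurd (hall ν hν hνlt u₀ u hLH hEu) (not_lt.2 hεle)

end Summit.AnomalousDissipation.AnomalousDissipation.Theorems

end
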